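import Summits.AtomisticToContinuum.BoseEinsteinCondensation.Theses.BECConjugateDomination
import Literature.MathematicalPhysics.QuantumManyBody.PeriodicClusteringFromKyFanGap
import Literature.MathematicalPhysics.QuantumManyBody.CondensateOccupationStability
import Literature.MathematicalPhysics.QuantumManyBody.PeriodicKineticBudget
import HarnessLib

/-!
# Truncation transfer from ENERGY CONVERGENCE and a Ky Fan gap UNIFORM ALONG THE TRUNCATIONS
# (line `third-law-current-floor`, crux `HardCoreExtension`, stmt-AtomisticToContinuum-11786):
# an alternative decomposition of the hard-core residue typed inside the bounded class

The line's S7 (`truncationTransfer`) turns condensed positive minimisers `Ψₙ` of the bounded truncations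
`vₙ = min(v, n)` into condensation of ALL `δ`-near-minimisers of `v` at fixed `(N, L)`. In skeleton v3.x this runs
through S7b (the `C¹` Bose core is a form core of the MAXIMAL hard-core form, stated for every finite-form `η`) and the
clustering of near-minimisers of `v` ITSELF (S5'' for unbounded `v`). This file proves (sorry-free) that the SAME
conclusion follows from two hypotheses that never leave the bounded class except through one scalar limit:

* (α') ENERGY CONVERGENCE along the truncations: `∀ ε > 0, ∃ n₀, ∀ n ≥ n₀, E₀(v) ≤ E₀(vₙ) + ε` (with the trivial
  `E₀(vₙ) ≤ E₀(v)` this is `E₀(vₙ) ↑ E₀(v)`; its content is the absence of a Lavrentiev gap between the `C¹` Bose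
  class vanishing on the hard set and the maximal form domain — implied by S7b ∘ compactness);
* (β') a Ky Fan gap of the truncations UNIFORM in `n`: `∃ γ > 0, ∃ n₀, ∀ n ≥ n₀, 2E₀(vₙ) + γ ≤ kyFanTwo vₙ N L`
  (the bounded class has the gap at each `n` by the tree's Perron–Frobenius/Feynman–Kac package; uniformity in `n`
  is the simplicity of the limit problem — it contains `LemmaGConnected` at hard cores exactly as S5'' does).

Mechanism (`stub_truncationTransferOfUniformGap`): a `δ`-near-minimiser `Φ` of `v` is a `(δ + E₀(v) − E₀(vₙ))`-near-
minimiser of `vₙ` (`periodicEnergy_mono_of_le`), hence a `2δ`-near-minimiser for `n ≥ n₀(δ)` by (α'); the Ky Fan gap of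
`vₙ` with the EXPLICIT slack `δ = γη/16` (`exists_phase_integral_norm_sub_sq_le_of_kyFanGap_explicit`, the tree lemma
with its constant exposed — uniformity in `n` is the whole point) clusters `Φ` around `Ψₙ` modulo a phase, and the
`2N√η`-Lipschitz continuity of `n₀` (`PeriodicTrialState.condensateOccupation_le_add_of_phase_sq_dist_le`) gives
`n₀(Φ) ≥ (c − ε)N` with `η = (ε/2)²`. [folklore]
-/

noncomputable section

namespace Summit.AtomisticToContinuum.BoseEinsteinCondensation.Cruxes.HardCoreExtension.ThirdLawCurrentFloor

open MeasureTheory Filter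
open scoped ENNReal NNReal BigOperators Topology ComplexConjugate
open Literature.MathematicalPhysics.QuantumManyBody.BoseGas

namespace UniformGapTransfer

variable {N : ℕ} {L : ℝ} {v : ℝ → ℝ≥0∞}

/-- `(‖z‖₊ : ℝ≥0∞)² = ofReal ‖z‖²` (local copy of the private tree lemma). [folklore] -/
private theorem ennreal_coe_nnnorm_sq' (z : ℂ) : ((‖z‖₊ : ℝ≥0∞)) ^ 2 = ENNReal.ofReal (‖z‖ ^ 2) := by
  rw [← ENNReal.coe_pow, ENNReal.ofReal, Real.toNNReal_pow (norm_nonneg _), norm_toNNReal]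

/-- **Clustering of near-minimisers from a Ky Fan gap, with the slack made explicit** (`δ = γη/16`): the tree lemma
`exists_phase_integral_norm_sub_sq_le_of_kyFanGap` with its constant exposed (same proof: parallelogram law for the
energy form on the orthogonal pair `Φ ± e^{iθ}Φ'` and Ky Fan's inequality). [folklore] -/
theorem exists_phase_integral_norm_sub_sq_le_of_kyFanGap_explicit (hv : Measurable v) {γ : ℝ}
    (hγ : 0 < γ) (hE : periodicGroundStateEnergy v N L ≠ ⊤)
    (hgap : 2 * periodicGroundStateEnergy v N L + ENNReal.ofReal γ ≤ kyFanTwo v N L)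
    {η : ℝ} (hη : 0 < η) (Φ Φ' : PeriodicTrialState N L)
    (hΦ : periodicEnergy v Φ ≤ periodicGroundStateEnergy v N L + ENNReal.ofReal (γ * η / 16))
    (hΦ' : periodicEnergy v Φ' ≤ periodicGroundStateEnergy v N L + ENNReal.ofReal (γ * η / 16)) :
    ∃ θ : ℝ, ∫ X in cellN N L, ‖Φ.ψ X - Complex.exp (θ * Complex.I) * Φ'.ψ X‖ ^ 2 ≤ η := by
  -- the phase aligning `Φ'` with `Φ`
  set s : ℂ := ∫ X in cellN N L, conj (Φ'.ψ X) * Φ.ψ X with hs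
  set c : ℂ := Complex.exp (↑(Complex.arg s) * Complex.I) with hc
  have hc1 : ‖c‖ = 1 := Complex.norm_exp_ofReal_mul_I _
  have hcc : conj c * c = 1 := by
    rw [Complex.conj_mul', hc1, Complex.ofReal_one, one_pow]
  have hs_polar : s = ↑‖s‖ * c := by rw [hc]; exact (Complex.norm_mul_exp_arg_mul_I s).symm
  have hcs : conj c * s = (‖s‖ : ℂ) := by
    calc conj c * s = conj c * (↑‖s‖ * c) := by rw [← hs_polar]
      _ = ↑‖s‖ * (conj c * c) := by ring
      _ = ↑‖s‖ := by rw [hcc, mul_one]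
  -- regularity of `Φ`, `cΦ'`, `u = Φ + cΦ'`, `w = Φ - cΦ'`
  have hΦc : Continuous Φ.ψ := Φ.contDiff.continuous
  have hΦ'c : Continuous Φ'.ψ := Φ'.contDiff.continuous
  have hcΦ' : ContDiff ℝ 1 (fun X => c * Φ'.ψ X) := contDiff_const.mul Φ'.contDiff
  have hCu : ContDiff ℝ 1 (fun X => Φ.ψ X + c * Φ'.ψ X) := Φ.contDiff.add hcΦ'
  have hCw : ContDiff ℝ 1 (fun X => Φ.ψ X - c * Φ'.ψ X) := Φ.contDiff.sub hcΦ'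
  have hper_u : ∀ (X : Config N) (i : Fin N) (k : Fin 3),
      Φ.ψ (X + Pi.single i (EuclideanSpace.single k L)) +
          c * Φ'.ψ (X + Pi.single i (EuclideanSpace.single k L)) = Φ.ψ X + c * Φ'.ψ X :=
    fun X i k => by rw [Φ.periodic, Φ'.periodic]
  have hper_w : ∀ (X : Config N) (i : Fin N) (k : Fin 3),
      Φ.ψ (X + Pi.single i (EuclideanSpace.single k L)) -
          c * Φ'.ψ (X + Pi.single i (EuclideanSpace.single k L)) = Φ.ψ X - c * Φ'.ψ X :=
    fun X i k => by rw [Φ.periodic, Φ'.periodic]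
  have hsymm_u : ∀ (σ : Equiv.Perm (Fin N)) (X : Config N),
      Φ.ψ (X ∘ σ) + c * Φ'.ψ (X ∘ σ) = Φ.ψ X + c * Φ'.ψ X :=
    fun σ X => by rw [Φ.symm, Φ'.symm]
  have hsymm_w : ∀ (σ : Equiv.Perm (Fin N)) (X : Config N),
      Φ.ψ (X ∘ σ) - c * Φ'.ψ (X ∘ σ) = Φ.ψ X - c * Φ'.ψ X :=
    fun σ X => by rw [Φ.symm, Φ'.symm]
  -- `‖cΦ'‖² = 1`, `q(cΦ') = q(Φ')`
  have hnΦ'' : ∫⁻ X in cellN N L, ((‖c * Φ'.ψ X‖₊ : ℝ≥0∞)) ^ 2 = 1 := by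
    rw [lintegral_cellN_sq_const_mul, Φ'.norm_eq, mul_one, ennreal_coe_nnnorm_sq', hc1, one_pow,
      ENNReal.ofReal_one]
  have hEΦ'' : ∫⁻ X in cellN N L, kineticDensity (fun Y => c * Φ'.ψ Y) X +
      periodicInteraction v L X * ((‖c * Φ'.ψ X‖₊ : ℝ≥0∞)) ^ 2 = periodicEnergy v Φ' := by
    rw [lintegral_periodicEnergy_const_mul v L c Φ'.contDiff, ennreal_coe_nnnorm_sq', hc1, one_pow,
      ENNReal.ofReal_one, one_mul]
    rfl
  -- (F1) `‖u‖² + ‖w‖² = 4`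
  have hpm : (∫⁻ X in cellN N L, ((‖Φ.ψ X + c * Φ'.ψ X‖₊ : ℝ≥0∞)) ^ 2) +
      (∫⁻ X in cellN N L, ((‖Φ.ψ X - c * Φ'.ψ X‖₊ : ℝ≥0∞)) ^ 2) = 4 := by
    rw [lintegral_cellN_sq_add_add_sub L hΦc hcΦ'.continuous, Φ.norm_eq, hnΦ'']
    norm_num
  -- (F2) `q(u) + q(w) ≤ 4E₀ + 4δ`
  have hab : (∫⁻ X in cellN N L, kineticDensity (fun Y => Φ.ψ Y + c * Φ'.ψ Y) X +
        periodicInteraction v L X * ((‖Φ.ψ X + c * Φ'.ψ X‖₊ : ℝ≥0∞)) ^ 2) +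
      (∫⁻ X in cellN N L, kineticDensity (fun Y => Φ.ψ Y - c * Φ'.ψ Y) X +
        periodicInteraction v L X * ((‖Φ.ψ X - c * Φ'.ψ X‖₊ : ℝ≥0∞)) ^ 2) ≤
      4 * periodicGroundStateEnergy v N L + 4 * ENNReal.ofReal (γ * η / 16) := by
    rw [lintegral_periodicEnergy_add_add_sub hv L Φ.contDiff hcΦ', hEΦ'']
    calc 2 * periodicEnergy v Φ + 2 * periodicEnergy v Φ'
        ≤ 2 * (periodicGroundStateEnergy v N L + ENNReal.ofReal (γ * η / 16)) +
          2 * (periodicGroundStateEnergy v N L + ENNReal.ofReal (γ * η / 16)) := by gcongr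
      _ = _ := by ring
  -- (F3) `u ⊥ w` in `L²(cell)`
  have hUW : ∫ X in cellN N L, conj (Φ.ψ X + c * Φ'.ψ X) * (Φ.ψ X - c * Φ'.ψ X) = 0 := by
    have hprod : (fun X => conj (Φ.ψ X + c * Φ'.ψ X) * (Φ.ψ X - c * Φ'.ψ X)) =
        fun X => (conj (Φ.ψ X) * Φ.ψ X - conj c * c * (conj (Φ'.ψ X) * Φ'.ψ X)) +
          (conj c * (conj (Φ'.ψ X) * Φ.ψ X) - conj (conj c * (conj (Φ'.ψ X) * Φ.ψ X))) := by
      funext X; simp only [map_mul, map_add, Complex.conj_conj]; ring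
    have hi1 : IntegrableOn (fun X => conj (Φ.ψ X) * Φ.ψ X) (cellN N L) :=
      integrableOn_cellN (hΦc.star.mul hΦc) L
    have hi4 : IntegrableOn (fun X => conj c * c * (conj (Φ'.ψ X) * Φ'.ψ X)) (cellN N L) :=
      integrableOn_cellN (continuous_const.mul (hΦ'c.star.mul hΦ'c)) L
    have hi3 : IntegrableOn (fun X => conj c * (conj (Φ'.ψ X) * Φ.ψ X)) (cellN N L) :=
      integrableOn_cellN (continuous_const.mul (hΦ'c.star.mul hΦc)) L
    have hi2 : IntegrableOn (fun X => conj (conj c * (conj (Φ'.ψ X) * Φ.ψ X))) (cellN N L) :=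
      integrableOn_cellN (continuous_const.mul (hΦ'c.star.mul hΦc)).star L
    have hi14 : IntegrableOn (fun X => conj (Φ.ψ X) * Φ.ψ X -
        conj c * c * (conj (Φ'.ψ X) * Φ'.ψ X)) (cellN N L) := hi1.sub hi4
    have hi32 : IntegrableOn (fun X => conj c * (conj (Φ'.ψ X) * Φ.ψ X) -
        conj (conj c * (conj (Φ'.ψ X) * Φ.ψ X))) (cellN N L) := hi3.sub hi2
    rw [hprod, integral_add hi14 hi32, integral_sub hi1 hi4, integral_sub hi3 hi2,
      integral_const_mul, integral_const_mul, integral_conj, integral_const_mul,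
      integral_cellN_conj_mul_self_trialState, integral_cellN_conj_mul_self_trialState, ← hs, hcs,
      hcc, Complex.conj_ofReal]
    ring
  -- energies of the normalised states
  have hEnorm : ∀ (U : Config N → ℂ), ContDiff ℝ 1 U → ∀ (Ψ : PeriodicTrialState N L) (a : ℝ),
      (Ψ.ψ = fun X => (a : ℂ) * U X) →
      periodicEnergy v Ψ = ((‖(a : ℂ)‖₊ : ℝ≥0∞)) ^ 2 * ∫⁻ X in cellN N L, kineticDensity U X +
        periodicInteraction v L X * ((‖U X‖₊ : ℝ≥0∞)) ^ 2 := by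
    intro U hU Ψ a h
    unfold periodicEnergy
    rw [h]
    exact lintegral_periodicEnergy_const_mul v L (a : ℂ) hU
  -- (F4) `E₀ ‖u‖² ≤ q(u)` and `E₀ ‖w‖² ≤ q(w)`
  have hFa : (∫⁻ X in cellN N L, ((‖Φ.ψ X + c * Φ'.ψ X‖₊ : ℝ≥0∞)) ^ 2) ≠ 0 →
      periodicGroundStateEnergy v N L *
          (∫⁻ X in cellN N L, ((‖Φ.ψ X + c * Φ'.ψ X‖₊ : ℝ≥0∞)) ^ 2) ≤
        ∫⁻ X in cellN N L, kineticDensity (fun Y => Φ.ψ Y + c * Φ'.ψ Y) X +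
          periodicInteraction v L X * ((‖Φ.ψ X + c * Φ'.ψ X‖₊ : ℝ≥0∞)) ^ 2 := by
    intro hp0
    have hp_top : (∫⁻ X in cellN N L, ((‖Φ.ψ X + c * Φ'.ψ X‖₊ : ℝ≥0∞)) ^ 2) ≠ ⊤ :=
      ne_top_of_le_ne_top (by norm_num) (hpm ▸ le_self_add)
    obtain ⟨û, a, hûψ, ha⟩ := exists_periodicTrialState_const_mul hCu hper_u hsymm_u hp0 hp_top
    have hEu := hEnorm _ hCu û a hûψ
    rw [ha] at hEu
    calc _ ≤ periodicEnergy v û * _ := mul_le_mul' (periodicGroundStateEnergy_le v û) le_rfl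
      _ = _ := by rw [hEu, mul_comm _⁻¹, mul_assoc, ENNReal.inv_mul_cancel hp0 hp_top, mul_one]
  have hFb : (∫⁻ X in cellN N L, ((‖Φ.ψ X - c * Φ'.ψ X‖₊ : ℝ≥0∞)) ^ 2) ≠ 0 →
      periodicGroundStateEnergy v N L *
          (∫⁻ X in cellN N L, ((‖Φ.ψ X - c * Φ'.ψ X‖₊ : ℝ≥0∞)) ^ 2) ≤
        ∫⁻ X in cellN N L, kineticDensity (fun Y => Φ.ψ Y - c * Φ'.ψ Y) X +
          periodicInteraction v L X * ((‖Φ.ψ X - c * Φ'.ψ X‖₊ : ℝ≥0∞)) ^ 2 := by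
    intro hm0
    have hm_top : (∫⁻ X in cellN N L, ((‖Φ.ψ X - c * Φ'.ψ X‖₊ : ℝ≥0∞)) ^ 2) ≠ ⊤ :=
      ne_top_of_le_ne_top (by norm_num) (hpm ▸ le_add_self)
    obtain ⟨ŵ, b, hŵψ, hb⟩ := exists_periodicTrialState_const_mul hCw hper_w hsymm_w hm0 hm_top
    have hEw := hEnorm _ hCw ŵ b hŵψ
    rw [hb] at hEw
    calc _ ≤ periodicEnergy v ŵ * _ := mul_le_mul' (periodicGroundStateEnergy_le v ŵ) le_rfl
      _ = _ := by rw [hEw, mul_comm _⁻¹, mul_assoc, ENNReal.inv_mul_cancel hm0 hm_top, mul_one]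
  -- (F5) the Ky Fan gap tested on the orthogonal pair `û, ŵ`
  have hF5 : (∫⁻ X in cellN N L, ((‖Φ.ψ X + c * Φ'.ψ X‖₊ : ℝ≥0∞)) ^ 2) ≠ 0 →
      (∫⁻ X in cellN N L, ((‖Φ.ψ X - c * Φ'.ψ X‖₊ : ℝ≥0∞)) ^ 2) ≠ 0 →
      2 * periodicGroundStateEnergy v N L + ENNReal.ofReal γ ≤
        (∫⁻ X in cellN N L, ((‖Φ.ψ X + c * Φ'.ψ X‖₊ : ℝ≥0∞)) ^ 2)⁻¹ *
          (∫⁻ X in cellN N L, kineticDensity (fun Y => Φ.ψ Y + c * Φ'.ψ Y) X +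
            periodicInteraction v L X * ((‖Φ.ψ X + c * Φ'.ψ X‖₊ : ℝ≥0∞)) ^ 2) +
        (∫⁻ X in cellN N L, ((‖Φ.ψ X - c * Φ'.ψ X‖₊ : ℝ≥0∞)) ^ 2)⁻¹ *
          (∫⁻ X in cellN N L, kineticDensity (fun Y => Φ.ψ Y - c * Φ'.ψ Y) X +
            periodicInteraction v L X * ((‖Φ.ψ X - c * Φ'.ψ X‖₊ : ℝ≥0∞)) ^ 2) := by
    intro hp0 hm0
    have hp_top : (∫⁻ X in cellN N L, ((‖Φ.ψ X + c * Φ'.ψ X‖₊ : ℝ≥0∞)) ^ 2) ≠ ⊤ :=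
      ne_top_of_le_ne_top (by norm_num) (hpm ▸ le_self_add)
    have hm_top : (∫⁻ X in cellN N L, ((‖Φ.ψ X - c * Φ'.ψ X‖₊ : ℝ≥0∞)) ^ 2) ≠ ⊤ :=
      ne_top_of_le_ne_top (by norm_num) (hpm ▸ le_add_self)
    obtain ⟨û, a, hûψ, ha⟩ := exists_periodicTrialState_const_mul hCu hper_u hsymm_u hp0 hp_top
    obtain ⟨ŵ, b, hŵψ, hb⟩ := exists_periodicTrialState_const_mul hCw hper_w hsymm_w hm0 hm_top
    have hEu := hEnorm _ hCu û a hûψ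
    rw [ha] at hEu
    have hEw := hEnorm _ hCw ŵ b hŵψ
    rw [hb] at hEw
    have horth : ∫ X in cellN N L, conj (û.ψ X) * ŵ.ψ X = 0 := by
      rw [hûψ, hŵψ]
      have h2 : (fun X => conj ((a : ℂ) * (Φ.ψ X + c * Φ'.ψ X)) * ((b : ℂ) * (Φ.ψ X - c * Φ'.ψ X))) =
          fun X => (conj (a : ℂ) * b) * (conj (Φ.ψ X + c * Φ'.ψ X) * (Φ.ψ X - c * Φ'.ψ X)) := by
        funext X; simp only [map_mul]; ring
      rw [h2, integral_const_mul, hUW, mul_zero]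
    calc 2 * periodicGroundStateEnergy v N L + ENNReal.ofReal γ ≤ kyFanTwo v N L := hgap
      _ ≤ periodicEnergy v û + periodicEnergy v ŵ :=
        (iInf_le _ û).trans ((iInf_le _ ŵ).trans (iInf_le _ horth))
      _ = _ := by rw [hEu, hEw]
  -- bookkeeping: `min(‖u‖², ‖w‖²) ≤ 8δ/γ = η/2`
  have key := min_toReal_le_of_kyFan_bookkeeping hγ (by positivity : (0 : ℝ) ≤ γ * η / 16) hE hpm
    hab hFa hFb hF5
  have key' : min (∫⁻ X in cellN N L, ((‖Φ.ψ X + c * Φ'.ψ X‖₊ : ℝ≥0∞)) ^ 2).toReal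
      (∫⁻ X in cellN N L, ((‖Φ.ψ X - c * Φ'.ψ X‖₊ : ℝ≥0∞)) ^ 2).toReal ≤ η := by
    calc _ ≤ 8 * (γ * η / 16) / γ := key
      _ = η / 2 := by field_simp; ring
      _ ≤ η := by linarith
  rcases le_total (∫⁻ X in cellN N L, ((‖Φ.ψ X - c * Φ'.ψ X‖₊ : ℝ≥0∞)) ^ 2).toReal
    (∫⁻ X in cellN N L, ((‖Φ.ψ X + c * Φ'.ψ X‖₊ : ℝ≥0∞)) ^ 2).toReal with h | h
  · -- `w = Φ - cΦ'` is the small one: `θ = arg s`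
    refine ⟨Complex.arg s, ?_⟩
    rw [← hc, integral_cellN_norm_sq_eq_toReal L (F := fun X => Φ.ψ X - c * Φ'.ψ X)
      (hΦc.sub hcΦ'.continuous)]
    exact (min_eq_right h ▸ key')
  · -- `u = Φ + cΦ'` is the small one: `θ = arg s + π`
    refine ⟨Complex.arg s + Real.pi, ?_⟩
    have hneg : Complex.exp (↑(Complex.arg s + Real.pi) * Complex.I) = -c := by
      rw [Complex.ofReal_add, add_mul, Complex.exp_add, Complex.exp_pi_mul_I, hc, mul_neg_one]
    simp_rw [hneg, neg_mul, sub_neg_eq_add]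
    rw [integral_cellN_norm_sq_eq_toReal L (F := fun X => Φ.ψ X + c * Φ'.ψ X)
      (hΦc.add hcΦ'.continuous)]
    exact (min_eq_left h ▸ key')


end UniformGapTransfer

open UniformGapTransfer

/-- **Truncation transfer from energy convergence and a uniform Ky Fan gap along the truncations** (registered stub
`stub_truncationTransferOfUniformGap`; conclusion verbatim that of the skeleton's `truncationTransfer`). At fixed `(N, L)`,
`L > 0`: if the truncation energies converge to `E₀(v)` (α'), the truncations have a Ky Fan gap `γ` uniform
in `n` (β'), and every truncation has a positive real minimiser with `n₀ ≥ cN`, then for every `ε > 0` there is `δ > 0`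
such that every `δ`-near-minimiser of `v` has `n₀ ≥ (c − ε)N`. [folklore] -/
theorem stub_truncationTransferOfUniformGap :
    ∀ v : ℝ → ℝ≥0∞, IsRepulsiveFiniteRange v → ∀ (N : ℕ) (L : ℝ), 0 < L →
      (∀ ε : ℝ, 0 < ε → ∃ n₀ : ℕ, ∀ n : ℕ, n₀ ≤ n →
        periodicGroundStateEnergy v N L ≤
          periodicGroundStateEnergy (fun r => min (v r) (n : ℝ≥0∞)) N L + ENNReal.ofReal ε) →
      (∃ γ : ℝ, 0 < γ ∧ ∃ n₀ : ℕ, ∀ n : ℕ, n₀ ≤ n →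
        2 * periodicGroundStateEnergy (fun r => min (v r) (n : ℝ≥0∞)) N L + ENNReal.ofReal γ ≤
          kyFanTwo (fun r => min (v r) (n : ℝ≥0∞)) N L) →
      ∀ c : ℝ,
      (∀ n : ℕ, ∃ Ψ : PeriodicTrialState N L,
        periodicEnergy (fun r => min (v r) (n : ℝ≥0∞)) Ψ =
          periodicGroundStateEnergy (fun r => min (v r) (n : ℝ≥0∞)) N L ∧
        periodicEnergy (fun r => min (v r) (n : ℝ≥0∞)) Ψ ≠ ⊤ ∧
        (∀ X, Ψ.ψ X = (‖Ψ.ψ X‖ : ℂ)) ∧ (∀ X, Ψ.ψ X ≠ 0) ∧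
        ENNReal.ofReal (c * N) ≤ condensateOccupation N L Ψ.ψ) →
      ∀ ε : ℝ, 0 < ε → ∃ δ : ℝ≥0∞, 0 < δ ∧ ∀ Φ : PeriodicTrialState N L,
        periodicEnergy v Φ ≤ periodicGroundStateEnergy v N L + δ →
        ENNReal.ofReal ((c - ε) * N) ≤ condensateOccupation N L Φ.ψ := by
  intro v hv N L hL hconv hgap c hmin ε hε
  obtain ⟨γ, hγ, n₀, hgapn⟩ := hgap
  -- the slack: half of the explicit clustering slack `γη/16`, `η = (ε/2)²`
  set η : ℝ := (ε / 2) ^ 2 with hηdef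
  have hη : 0 < η := by positivity
  set d : ℝ := γ * η / 32 with hd
  have hd0 : 0 < d := by positivity
  obtain ⟨n₁, hconvn⟩ := hconv d hd0
  refine ⟨ENNReal.ofReal d, ENNReal.ofReal_pos.2 hd0, fun Φ hΦ => ?_⟩
  -- the truncation height
  set n : ℕ := max n₀ n₁ with hndef
  obtain ⟨Ψ, hΨE, hΨfin, -, -, hΨocc⟩ := hmin n
  have hvn : Measurable fun r => min (v r) (n : ℝ≥0∞) := hv.1.min measurable_const
  have hEn : periodicGroundStateEnergy (fun r => min (v r) (n : ℝ≥0∞)) N L ≠ ⊤ := by rwa [← hΨE]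
  -- `Φ` is a `2d`-near-minimiser of the truncation
  have h2d : ENNReal.ofReal d + ENNReal.ofReal d = ENNReal.ofReal (γ * η / 16) := by
    rw [← ENNReal.ofReal_add hd0.le hd0.le]; congr 1; rw [hd]; ring
  have hΦn : periodicEnergy (fun r => min (v r) (n : ℝ≥0∞)) Φ ≤
      periodicGroundStateEnergy (fun r => min (v r) (n : ℝ≥0∞)) N L + ENNReal.ofReal (γ * η / 16) := by
    calc periodicEnergy (fun r => min (v r) (n : ℝ≥0∞)) Φ ≤ periodicEnergy v Φ :=
          periodicEnergy_mono_of_le (fun r => min_le_left _ _) Φ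
      _ ≤ periodicGroundStateEnergy v N L + ENNReal.ofReal d := hΦ
      _ ≤ periodicGroundStateEnergy (fun r => min (v r) (n : ℝ≥0∞)) N L + ENNReal.ofReal d +
            ENNReal.ofReal d := by
          gcongr
          exact hconvn n (le_max_right _ _)
      _ = _ := by rw [add_assoc, h2d]
  have hΨn : periodicEnergy (fun r => min (v r) (n : ℝ≥0∞)) Ψ ≤
      periodicGroundStateEnergy (fun r => min (v r) (n : ℝ≥0∞)) N L + ENNReal.ofReal (γ * η / 16) :=
    hΨE.le.trans le_self_add
  -- clustering of `Φ` around `Ψ` modulo a phase, from the uniform gap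
  obtain ⟨θ, hθ⟩ := exists_phase_integral_norm_sub_sq_le_of_kyFanGap_explicit hvn hγ hEn
    (hgapn n (le_max_left _ _)) hη Φ Ψ hΦn hΨn
  -- Lipschitz continuity of `n₀`
  have hlip := PeriodicTrialState.condensateOccupation_le_add_of_phase_sq_dist_le hL Φ Ψ hθ
  rw [hηdef, Real.sqrt_sq (by positivity)] at hlip
  refine ofReal_sub_mul_le_of_le_add hε.le N (hΨocc.trans (hlip.trans (le_of_eq ?_)))
  congr 2
  ring

end Summit.AtomisticToContinuum.BoseEinsteinCondensation.Cruxes.HardCoreExtension.ThirdLawCurrentFloor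

end
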